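import Mathlib.Analysis.SpecialFunctions.Integrals.Basic
import Summits.QuantumFields.YangMills.Theorems.BalabanUVNodesN19TriangleWaveBessel

/-!
# N19 (NE7, s3 ALTERNATIVE CURRENCY) — Lacunary cosine sums: non-resonant products integrate to zero

Module 93 of the `dag-n19-e` lineage (uniform-moment currency, fixed observables; CURRENCY-MAP v3 item
(w′)), the arithmetic half of the Riesz-product engine of module 94.

* §1 `∫_0^π (∏_{k∈S} cos(λ_kφ))·cos(νφ)dφ = 0` as soon as no sign vector solves `Σ_{k∈S} ±λ_k = ±ν`
  (★ `integral_prod_cos_mul_cos_eq_zero`; Finset induction with `2cos x cos y = cos(x−y) + cos(x+y)`),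
  and the resonant singleton `∫_0^π cos²(λ_jφ)dφ = π∕2` (module 85).
* §2 the lacunary frequencies `λ_k = 4^{k+1} + 1` are DISSOCIATE in the sense §1 needs: below the top
  index `K` one has `12·|Σ'| ≤ 5·4^{K+1} − 16` (`abs_signedSum_le`), at the top index
  `7·4^{K+1} + 28 ≤ 12·|Σ| ≤ 17·4^{K+1} − 4` (`abs_signedSum_ge`); hence no signed sum of distinct `λ_k`
  equals `±(λ_j + 2)` (★ `signedSum_ne_shifted`) and `±λ_j` is attained only by the singleton `{j}`
  (★ `signedSum_eq_lacFreq`).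

HONEST FRAMING: [folklore] elementary harmonic analysis ∕ arithmetic over Mathlib and module 85 BY NAME;
no consumer in the DAG today; nothing of Bałaban's is instantiated; NE7 is NOT PRINTED and NOT proved
here; N19 is NOT discharged; count-neutral.  One finite 𝕋⁴ programme at fixed ε; nothing continuum ∕
OS ∕ mass-gap ∕ Clay.
-/

open Real Finset MeasureTheory

namespace Summit.QuantumFields.YangMills.Theorems.BalabanUVNodesN19LacunaryCosineSums

/-! ## §1 Products of cosines integrate to zero against non-resonant frequencies [folklore] -/

/-- `∫_0^π cos(Nφ)dφ = 0` for every nonzero integer `N`. [folklore] -/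
theorem integral_cos_int_mul {N : ℤ} (hN : N ≠ 0) :
    ∫ φ in (0 : ℝ)..π, Real.cos (N * φ) = 0 := by
  have hN' : (N : ℝ) ≠ 0 := Int.cast_ne_zero.2 hN
  rw [intervalIntegral.integral_comp_mul_left (fun x => Real.cos x) hN', integral_cos]
  simp [Real.sin_int_mul_pi]

/-- Continuity of a finite product of cosines. [bookkeeping] -/
theorem continuous_prod_cos (S : Finset ℕ) (lam : ℕ → ℤ) :
    Continuous fun φ : ℝ => ∏ k ∈ S, Real.cos (lam k * φ) :=
  continuous_finsetProd S fun _ _ => Real.continuous_cos.comp (continuous_const.mul continuous_id)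

/-- ★ **NON-RESONANT PRODUCTS OF COSINES INTEGRATE TO ZERO.**  If no choice of signs `ε_k = ±1`
(`k ∈ S`) gives `Σ_{k∈S} ε_kλ_k = ±ν`, then `∫_0^π (∏_{k∈S} cos(λ_kφ))·cos(νφ)dφ = 0`.  (Induction on `S`
with `2cos x cos y = cos(x−y) + cos(x+y)`; the empty product needs `ν ≠ 0`.) [folklore] -/
theorem integral_prod_cos_mul_cos_eq_zero (lam : ℕ → ℤ) (S : Finset ℕ) (ν : ℤ)
    (h : ∀ ε : ℕ → ℤ, (∀ k ∈ S, ε k = 1 ∨ ε k = -1) →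
      (∑ k ∈ S, ε k * lam k) ≠ ν ∧ (∑ k ∈ S, ε k * lam k) ≠ -ν) :
    ∫ φ in (0 : ℝ)..π, (∏ k ∈ S, Real.cos (lam k * φ)) * Real.cos (ν * φ) = 0 := by
  classical
  induction S using Finset.induction_on generalizing ν with
  | empty =>
    have h0 := (h (fun _ => 1) (by simp)).1
    simp only [Finset.sum_empty, ne_eq] at h0
    have hν : ν ≠ 0 := fun h' => h0 (h'.symm ▸ rfl)
    simp only [Finset.prod_empty, one_mul]
    exact integral_cos_int_mul hν
  | insert a S ha IH =>
    -- the sign hypotheses for `S` at the shifted frequencies `ν ∓ λ_a`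
    have hS : ∀ (σ : ℤ), (σ = 1 ∨ σ = -1) → ∀ ε : ℕ → ℤ, (∀ k ∈ S, ε k = 1 ∨ ε k = -1) →
        (∑ k ∈ S, ε k * lam k) ≠ ν - σ * lam a ∧ (∑ k ∈ S, ε k * lam k) ≠ -ν - σ * lam a := by
      intro σ hσ ε hε
      set ε' : ℕ → ℤ := fun k => if k = a then σ else ε k with hε'
      have hε'S : ∀ k ∈ insert a S, ε' k = 1 ∨ ε' k = -1 := by
        intro k hk
        rcases Finset.mem_insert.1 hk with rfl | hk
        · simp [hε', hσ]
        · have : k ≠ a := fun h' => ha (h' ▸ hk)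
          simp [hε', this, hε k hk]
      have hsum : ∑ k ∈ insert a S, ε' k * lam k = σ * lam a + ∑ k ∈ S, ε k * lam k := by
        rw [Finset.sum_insert ha]
        congr 1
        · simp [hε']
        · refine Finset.sum_congr rfl fun k hk => ?_
          have : k ≠ a := fun h' => ha (h' ▸ hk)
          simp [hε', this]
      have h1 := h ε' hε'S
      rw [hsum] at h1
      constructor
      · intro h'; exact h1.1 (by rw [h']; ring)
      · intro h'; exact h1.2 (by rw [h']; ring)
    have IH1 := IH (ν - lam a) fun ε hε => by
      have h1 := hS 1 (Or.inl rfl) ε hε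
      have h2 := hS (-1) (Or.inr rfl) ε hε
      refine ⟨by simpa using h1.1, ?_⟩
      intro h'; exact h2.2 (by rw [h']; ring)
    have IH2 := IH (ν + lam a) fun ε hε => by
      have h1 := hS 1 (Or.inl rfl) ε hε
      have h2 := hS (-1) (Or.inr rfl) ε hε
      refine ⟨?_, ?_⟩
      · intro h'; exact h2.1 (by rw [h']; ring)
      · intro h'; exact h1.2 (by rw [h']; ring)
    -- the integrand splits by the product formula
    have hsplit : (fun φ : ℝ => (∏ k ∈ insert a S, Real.cos (lam k * φ)) * Real.cos (ν * φ)) =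
        fun φ => (1 / 2 : ℝ) * ((∏ k ∈ S, Real.cos (lam k * φ)) * Real.cos (((ν - lam a : ℤ) : ℝ) * φ)) +
          (1 / 2 : ℝ) * ((∏ k ∈ S, Real.cos (lam k * φ)) * Real.cos (((ν + lam a : ℤ) : ℝ) * φ)) := by
      funext φ
      rw [Finset.prod_insert ha]
      have e1 : ((ν - lam a : ℤ) : ℝ) * φ = ν * φ - lam a * φ := by push_cast; ring
      have e2 : ((ν + lam a : ℤ) : ℝ) * φ = ν * φ + lam a * φ := by push_cast; ring
      rw [e1, e2]
      linear_combination (1 / 2 : ℝ) * (∏ k ∈ S, Real.cos (lam k * φ)) *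
        Real.two_mul_cos_mul_cos (ν * φ) (lam a * φ)
    have hc1 : Continuous fun φ : ℝ => (∏ k ∈ S, Real.cos (lam k * φ)) * Real.cos (((ν - lam a : ℤ) : ℝ) * φ) :=
      (continuous_prod_cos S lam).mul (Real.continuous_cos.comp (continuous_const.mul continuous_id))
    have hc2 : Continuous fun φ : ℝ => (∏ k ∈ S, Real.cos (lam k * φ)) * Real.cos (((ν + lam a : ℤ) : ℝ) * φ) :=
      (continuous_prod_cos S lam).mul (Real.continuous_cos.comp (continuous_const.mul continuous_id))
    rw [hsplit, intervalIntegral.integral_add ((hc1.intervalIntegrable _ _).const_mul _)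
      ((hc2.intervalIntegrable _ _).const_mul _), intervalIntegral.integral_const_mul,
      intervalIntegral.integral_const_mul, IH1, IH2]
    ring

/-- The resonant case used below: `∫_0^π (∏_{k∈{j}} cos(λ_kφ))·cos(λ_jφ)dφ = π∕2` for a natural
frequency `λ_j ≥ 1`. [folklore] -/
theorem integral_prod_cos_singleton_mul_cos {n : ℕ} (hn : n ≠ 0) (j : ℕ) (lam : ℕ → ℤ) (hj : lam j = n) :
    ∫ φ in (0 : ℝ)..π, (∏ k ∈ ({j} : Finset ℕ), Real.cos (lam k * φ)) * Real.cos (lam j * φ) = π / 2 := by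
  simp only [Finset.prod_singleton, hj, Int.cast_natCast]
  exact BalabanUVNodesN19TriangleWaveBessel.integral_cos_nat_mul_sq hn

/-! ## §2 The lacunary frequencies `4^{k+1} + 1`: the top term dominates [folklore] -/

/-- `3·Σ_{k<K} 4^{k+1} = 4^{K+1} − 4`. [bookkeeping] -/
theorem three_mul_sum_pow_four (K : ℕ) :
    3 * ∑ k ∈ range K, (4 : ℤ) ^ (k + 1) = 4 ^ (K + 1) - 4 := by
  induction K with
  | zero => simp
  | succ K ih => rw [Finset.sum_range_succ, mul_add, ih]; ring

/-- `3K ≤ 4^K`. [bookkeeping] -/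
theorem three_mul_le_pow_four (K : ℕ) : 3 * (K : ℤ) ≤ 4 ^ K := by
  induction K with
  | zero => simp
  | succ K ih =>
    have h4 : (4 : ℤ) ^ K ≥ 1 := one_le_pow₀ (by norm_num)
    push_cast; rw [pow_succ]; nlinarith

/-- UPPER BOUND below the top index: for `S ⊆ {0,…,K−1}` and coefficients `|ε_k| ≤ 1`,
`12·|Σ_{k∈S} ε_k(4^{k+1}+1)| ≤ 5·4^{K+1} − 16`. [folklore] -/
theorem abs_signedSum_le {S : Finset ℕ} {K : ℕ} (hS : S ⊆ range K) (ε : ℕ → ℤ)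
    (hε : ∀ k ∈ S, |ε k| ≤ 1) :
    12 * |∑ k ∈ S, ε k * ((4 : ℤ) ^ (k + 1) + 1)| ≤ 5 * 4 ^ (K + 1) - 16 := by
  have h1 : |∑ k ∈ S, ε k * ((4 : ℤ) ^ (k + 1) + 1)| ≤ ∑ k ∈ S, ((4 : ℤ) ^ (k + 1) + 1) := by
    refine (Finset.abs_sum_le_sum_abs _ _).trans (Finset.sum_le_sum fun k hk => ?_)
    rw [abs_mul, abs_of_pos (by positivity : (0 : ℤ) < 4 ^ (k + 1) + 1)]
    calc |ε k| * ((4 : ℤ) ^ (k + 1) + 1) ≤ 1 * (4 ^ (k + 1) + 1) :=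
          mul_le_mul_of_nonneg_right (hε k hk) (by positivity)
      _ = _ := one_mul _
  have h2 : ∑ k ∈ S, ((4 : ℤ) ^ (k + 1) + 1) ≤ ∑ k ∈ range K, ((4 : ℤ) ^ (k + 1) + 1) :=
    Finset.sum_le_sum_of_subset_of_nonneg hS fun k _ _ => by positivity
  have h3 : ∑ k ∈ range K, ((4 : ℤ) ^ (k + 1) + 1) = ∑ k ∈ range K, (4 : ℤ) ^ (k + 1) + K := by
    rw [Finset.sum_add_distrib]; simp
  have h4 := three_mul_sum_pow_four K
  have h5 := three_mul_le_pow_four K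
  have h6 : (4 : ℤ) ^ (K + 1) = 4 * 4 ^ K := by ring
  nlinarith [h1, h2, h3, h4, h5, h6, abs_nonneg (∑ k ∈ S, ε k * ((4 : ℤ) ^ (k + 1) + 1))]

/-- LOWER BOUND at the top index: for a nonempty `S` with maximum `K` and signs `ε_k = ±1`,
`12·|Σ_{k∈S} ε_k(4^{k+1}+1)| ≥ 7·4^{K+1} + 28`, and the remainder after removing the top term satisfies
the upper bound of `abs_signedSum_le`. [folklore] -/
theorem abs_signedSum_ge {S : Finset ℕ} (hne : S.Nonempty) (ε : ℕ → ℤ)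
    (hε : ∀ k ∈ S, ε k = 1 ∨ ε k = -1) :
    7 * 4 ^ (S.max' hne + 1) + 28 ≤ 12 * |∑ k ∈ S, ε k * ((4 : ℤ) ^ (k + 1) + 1)| ∧
    12 * |∑ k ∈ S, ε k * ((4 : ℤ) ^ (k + 1) + 1)| ≤ 17 * 4 ^ (S.max' hne + 1) - 4 ∧
    ∑ k ∈ S, ε k * ((4 : ℤ) ^ (k + 1) + 1) =
      ε (S.max' hne) * (4 ^ (S.max' hne + 1) + 1) + ∑ k ∈ S.erase (S.max' hne), ε k * ((4 : ℤ) ^ (k + 1) + 1) ∧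
    12 * |∑ k ∈ S.erase (S.max' hne), ε k * ((4 : ℤ) ^ (k + 1) + 1)| ≤ 5 * 4 ^ (S.max' hne + 1) - 16 := by
  classical
  set K := S.max' hne with hK
  have hKmem : K ∈ S := Finset.max'_mem S hne
  have hsplit : ∑ k ∈ S, ε k * ((4 : ℤ) ^ (k + 1) + 1) =
      ε K * (4 ^ (K + 1) + 1) + ∑ k ∈ S.erase K, ε k * ((4 : ℤ) ^ (k + 1) + 1) :=
    (Finset.add_sum_erase S (fun k => ε k * ((4 : ℤ) ^ (k + 1) + 1)) hKmem).symm
  have hsub : S.erase K ⊆ range K := by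
    intro k hk
    rw [Finset.mem_erase] at hk
    exact Finset.mem_range.2 (lt_of_le_of_ne (Finset.le_max' S k hk.2) hk.1)
  have hrest := abs_signedSum_le hsub ε fun k hk => by
    rcases hε k (Finset.mem_of_mem_erase hk) with h | h <;> simp [h]
  set T' := ∑ k ∈ S.erase K, ε k * ((4 : ℤ) ^ (k + 1) + 1) with hT'
  have hA : (4 : ℤ) ^ (K + 1) ≥ 4 := by
    calc (4 : ℤ) ^ (K + 1) ≥ 4 ^ 1 := pow_le_pow_right₀ (by norm_num) (by omega)
      _ = 4 := by norm_num
  refine ⟨?_, ?_, hsplit, hrest⟩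
  · rw [hsplit]
    rcases hε K hKmem with h | h
    · rw [h, one_mul]
      have := abs_sub_abs_le_abs_add ((4 : ℤ) ^ (K + 1) + 1) T'
      rw [abs_of_pos (by positivity : (0 : ℤ) < 4 ^ (K + 1) + 1)] at this
      nlinarith [this, hrest]
    · rw [h, neg_one_mul]
      have := abs_sub_abs_le_abs_sub (-((4 : ℤ) ^ (K + 1) + 1)) (-T')
      rw [abs_neg, abs_neg, abs_of_pos (by positivity : (0 : ℤ) < 4 ^ (K + 1) + 1),
        show -((4 : ℤ) ^ (K + 1) + 1) - -T' = -(4 ^ (K + 1) + 1) + T' by ring] at this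
      nlinarith [this, hrest]
  · rw [hsplit]
    have := abs_add_le (ε K * ((4 : ℤ) ^ (K + 1) + 1)) T'
    have hεK : |ε K * ((4 : ℤ) ^ (K + 1) + 1)| = 4 ^ (K + 1) + 1 := by
      rw [abs_mul, abs_of_pos (by positivity : (0 : ℤ) < 4 ^ (K + 1) + 1)]
      rcases hε K hKmem with h | h <;> simp [h]
    nlinarith [this, hεK, hrest]

/-- ★ DISSOCIATIVITY (a): no signed sum of distinct `4^{k+1}+1` equals `±(4^{j+1}+3)`. [folklore] -/
theorem signedSum_ne_shifted (S : Finset ℕ) (ε : ℕ → ℤ) (hε : ∀ k ∈ S, ε k = 1 ∨ ε k = -1) (j : ℕ) :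
    (∑ k ∈ S, ε k * ((4 : ℤ) ^ (k + 1) + 1)) ≠ 4 ^ (j + 1) + 3 ∧
    (∑ k ∈ S, ε k * ((4 : ℤ) ^ (k + 1) + 1)) ≠ -(4 ^ (j + 1) + 3) := by
  classical
  have hB : (4 : ℤ) ^ (j + 1) ≥ 4 := by
    calc (4 : ℤ) ^ (j + 1) ≥ 4 ^ 1 := pow_le_pow_right₀ (by norm_num) (by omega)
      _ = 4 := by norm_num
  rcases S.eq_empty_or_nonempty with rfl | hne
  · simp only [Finset.sum_empty]; constructor <;> intro h <;> linarith
  obtain ⟨hlo, hhi, hsplit, hrest⟩ := abs_signedSum_ge hne ε hε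
  set K := S.max' hne with hK
  set T := ∑ k ∈ S, ε k * ((4 : ℤ) ^ (k + 1) + 1) with hT
  set T' := ∑ k ∈ S.erase K, ε k * ((4 : ℤ) ^ (k + 1) + 1) with hT'
  -- if `|T| = 4^{j+1} + 3` then `j = K`, and then the remainder is `±2` or `±(2·4^{K+1}+4)`: both impossible
  have key : |T| ≠ 4 ^ (j + 1) + 3 := by
    intro habs
    rcases lt_trichotomy j K with hjK | hjK | hKj
    · -- `4^{j+1} ≤ 4^{K+1}∕4`
      have : (4 : ℤ) ^ (j + 1) * 4 ≤ 4 ^ (K + 1) := by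
        rw [← pow_succ]; exact pow_le_pow_right₀ (by norm_num) (by omega)
      nlinarith
    · -- `j = K`: look at the remainder
      rw [hjK] at habs
      have hKmem : K ∈ S := Finset.max'_mem S hne
      have hS' : S.erase K = ∅ ∨ (S.erase K).Nonempty := (S.erase K).eq_empty_or_nonempty
      have hrem : T' = T - ε K * (4 ^ (K + 1) + 1) := by rw [hsplit]; ring
      have hsmall : ∀ hne' : (S.erase K).Nonempty, 56 ≤ 12 * |T'| := fun hne' => by
        obtain ⟨hlo', -, -, -⟩ := abs_signedSum_ge hne' ε fun k hk => hε k (Finset.mem_of_mem_erase hk)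
        have h4 : (4 : ℤ) ^ ((S.erase K).max' hne' + 1) ≥ 4 := by
          calc (4 : ℤ) ^ ((S.erase K).max' hne' + 1) ≥ 4 ^ 1 := pow_le_pow_right₀ (by norm_num) (by omega)
            _ = 4 := by norm_num
        rw [← hT'] at hlo'
        linarith
      rcases hε K hKmem with h | h
      · -- ε_K = 1
        rw [h, one_mul] at hrem
        rcases (abs_eq (by positivity : (0 : ℤ) ≤ 4 ^ (K + 1) + 3)).1 habs with hT1 | hT1
        · -- T' = 2
          have hT'2 : T' = 2 := by rw [hrem, hT1]; ring
          rcases hS' with he | hne'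
          · rw [hT', he, Finset.sum_empty] at hT'2; exact absurd hT'2 (by norm_num)
          · have := hsmall hne'; rw [hT'2] at this; norm_num at this
        · -- T' = −2·4^{K+1} − 4
          have : T' = -(2 * 4 ^ (K + 1) + 4) := by rw [hrem, hT1]; ring
          rw [this, abs_neg, abs_of_pos (by positivity : (0 : ℤ) < 2 * 4 ^ (K + 1) + 4)] at hrest
          linarith
      · rw [h, neg_one_mul] at hrem
        rcases (abs_eq (by positivity : (0 : ℤ) ≤ 4 ^ (K + 1) + 3)).1 habs with hT1 | hT1
        · have : T' = 2 * 4 ^ (K + 1) + 4 := by rw [hrem, hT1]; ring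
          rw [this, abs_of_pos (by positivity : (0 : ℤ) < 2 * 4 ^ (K + 1) + 4)] at hrest
          linarith
        · have hT'2 : T' = -2 := by rw [hrem, hT1]; ring
          rcases hS' with he | hne'
          · rw [hT', he, Finset.sum_empty] at hT'2; exact absurd hT'2 (by norm_num)
          · have := hsmall hne'; rw [hT'2] at this; norm_num at this
    · -- `4^{j+1} ≥ 4·4^{K+1}`
      have : (4 : ℤ) ^ (K + 1) * 4 ≤ 4 ^ (j + 1) := by
        rw [← pow_succ]; exact pow_le_pow_right₀ (by norm_num) (by omega)
      nlinarith
  constructor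
  · intro h; exact key (by rw [h]; exact abs_of_pos (by positivity))
  · intro h; exact key (by rw [h, abs_neg]; exact abs_of_pos (by positivity))

/-- ★ DISSOCIATIVITY (b): a signed sum of distinct `4^{k+1}+1` equals `±(4^{j+1}+1)` only for the
singleton `S = {j}`. [folklore] -/
theorem signedSum_eq_lacFreq (S : Finset ℕ) (ε : ℕ → ℤ) (hε : ∀ k ∈ S, ε k = 1 ∨ ε k = -1) (j : ℕ)
    (h : (∑ k ∈ S, ε k * ((4 : ℤ) ^ (k + 1) + 1)) = 4 ^ (j + 1) + 1 ∨
      (∑ k ∈ S, ε k * ((4 : ℤ) ^ (k + 1) + 1)) = -(4 ^ (j + 1) + 1)) :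
    S = {j} := by
  classical
  have hB : (4 : ℤ) ^ (j + 1) ≥ 4 := by
    calc (4 : ℤ) ^ (j + 1) ≥ 4 ^ 1 := pow_le_pow_right₀ (by norm_num) (by omega)
      _ = 4 := by norm_num
  rcases S.eq_empty_or_nonempty with rfl | hne
  · simp only [Finset.sum_empty] at h; rcases h with h | h <;> linarith
  obtain ⟨hlo, hhi, hsplit, hrest⟩ := abs_signedSum_ge hne ε hε
  set K := S.max' hne with hK
  set T := ∑ k ∈ S, ε k * ((4 : ℤ) ^ (k + 1) + 1) with hT
  set T' := ∑ k ∈ S.erase K, ε k * ((4 : ℤ) ^ (k + 1) + 1) with hT'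
  have habs : |T| = 4 ^ (j + 1) + 1 := by
    rcases h with h | h
    · rw [h]; exact abs_of_pos (by positivity)
    · rw [h, abs_neg]; exact abs_of_pos (by positivity)
  rcases lt_trichotomy j K with hjK | hjK | hKj
  · have : (4 : ℤ) ^ (j + 1) * 4 ≤ 4 ^ (K + 1) := by
      rw [← pow_succ]; exact pow_le_pow_right₀ (by norm_num) (by omega)
    nlinarith
  · -- `j = K`: the remainder vanishes, hence `S.erase K = ∅`
    subst hjK
    have hrem : T' = T - ε (S.max' hne) * (4 ^ (S.max' hne + 1) + 1) := by rw [hsplit]; ring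
    have hT'0 : T' = 0 := by
      rcases hε (S.max' hne) (Finset.max'_mem S hne) with he | he
      · rw [he, one_mul] at hrem
        rcases (abs_eq (by positivity : (0 : ℤ) ≤ 4 ^ (S.max' hne + 1) + 1)).1 habs with hT1 | hT1
        · rw [hrem, hT1]; ring
        · have : T' = -(2 * 4 ^ (S.max' hne + 1) + 2) := by rw [hrem, hT1]; ring
          rw [this, abs_neg, abs_of_pos (by positivity : (0 : ℤ) < 2 * 4 ^ (S.max' hne + 1) + 2)] at hrest
          linarith
      · rw [he, neg_one_mul] at hrem
        rcases (abs_eq (by positivity : (0 : ℤ) ≤ 4 ^ (S.max' hne + 1) + 1)).1 habs with hT1 | hT1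
        · have : T' = 2 * 4 ^ (S.max' hne + 1) + 2 := by rw [hrem, hT1]; ring
          rw [this, abs_of_pos (by positivity : (0 : ℤ) < 2 * 4 ^ (S.max' hne + 1) + 2)] at hrest
          linarith
        · rw [hrem, hT1]; ring
    have hempty : S.erase (S.max' hne) = ∅ := by
      by_contra hne'
      obtain ⟨hlo', -, -, -⟩ := abs_signedSum_ge (Finset.nonempty_iff_ne_empty.2 hne') ε
        fun k hk => hε k (Finset.mem_of_mem_erase hk)
      rw [← hT', hT'0, abs_zero, mul_zero] at hlo'
      have : (0 : ℤ) < 4 ^ ((S.erase (S.max' hne)).max' (Finset.nonempty_iff_ne_empty.2 hne') + 1) := by positivity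
      linarith
    rw [← Finset.insert_erase (Finset.max'_mem S hne), hempty]
    rfl
  · have : (4 : ℤ) ^ (K + 1) * 4 ≤ 4 ^ (j + 1) := by
      rw [← pow_succ]; exact pow_le_pow_right₀ (by norm_num) (by omega)
    nlinarith

end Summit.QuantumFields.YangMills.Theorems.BalabanUVNodesN19LacunaryCosineSums
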